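import Mathlib
import HarnessLib
import HarnessLib.Audit
import Summits.NavierStokesRegularity.Statement
import Literature.Analysis.FluidPDE.ClassicalSolution
import Literature.Analysis.FluidPDE.LerayHopf
import Literature.Analysis.FluidPDE.SuitableWeak
import Literature.Analysis.FluidPDE.HelicalSectorSeminorm
import Literature.Analysis.FluidPDE.HelicalSectorTransfer
import Literature.Analysis.FunctionSpaces.FourierSobolevNorm
import Literature.Analysis.FunctionSpaces.Complexify
import Summits.NavierStokesRegularity.NavierStokesRegularity.Theorems.NoBlowupToClay
import Summits.NavierStokesRegularity.NavierStokesRegularity.Theses.RootDecompChiralityLadder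
import Summits.NavierStokesRegularity.NavierStokesRegularity.Theorems.LocalLambTubeDoorTargetClose
import HarnessLib.Audit.Status.Attr

/-!
Route: RootDecompChiralSerrin

# Route RootDecompChiralSerrin — Chiral Serrin ladder + transfer-geometry floor — interior
one-sector Serrin rungs and a flat-transfer criterion below N12's ambichiral residual

ROOT DECOMPOSITION CELL decomp-ns (D-0178/D-0179, RESIDUAL MODE, blocker-first), node booked by
route-writer decomp-ns-writer-1 (g3) from the lens-1 g6 BOOKING KIT (HOME =
run/shared/lean/pub/decomp-ns/; seat file HOME/decomp-ns-lens-1/ChiralSerrinLadder.lean REV1 sha256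
64789f5b125f7980ef564773e1d68259514e279d19794b1022de2c97e40518c1 (428 lines, lean rc 0 / 0 sorry;
imports the ACCEPTED definitions module Literature.Analysis.FluidPDE.HelicalSectorTransfer =
p763809, commit 651fa87fcaa4); node card HOME/decomp-ns-lens-1/NODE-g6.md sha256
1b63c6b344f07647751591eee924442d32ec72f051e7964329e98b226c9a058d; kit
HOME/decomp-ns-lens-1/kit-ChiralSerrin/; CRITIC-LEDGER rows 72 CLEARED (2026-08-30T06:29:49Z) and 77
REV1 CLEARED «bookable form» (07:04:34Z); census HOME/census/COSTUME-CENSUS-v4.md sha256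
e828b1876d5b3b55654ec8f343ae625c4a0978033b8a85e9ad11ef880e05aa46). PARENT POINTER: child of N12
`route-NavierStokesRegularity-RootDecompChiralityLadder` at its declared residual X₃′ =
stmt-NavierStokesRegularity-28743 (X₃′ REPLACED here by S ∧ G ∧ X₃″, kernel `X₃'_iff_recut` EXACT);
X₁ = 28741, X₂ = 28742, P1 = 1217 carried VERBATIM (dedup by signature); concludes the ROOT.

Root decomposition node (decomp-ns lens-1 «grading / quantitative ladder», gen 6, RESIDUAL MODE;
child of N12 =
route-NavierStokesRegularity-RootDecompChiralityLadder at its declared residual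
NoAmbichiralTypeIIBlowup = stmt-NavierStokesRegularity-28743,
under the B1 blocker stmt-0056). It suffices to show X = X₁ ∧ X₂ ∧ S ∧ G ∧ X₃″ ∧ P1: X₁ =
OneSectorDissipationExtends (28741) and
X₂ = OneSectorCriticalExtends (28742) are N12's endpoint rungs r = 2, r = ∞ of the
one-helical-sector scale; S = OneSectorSerrinExtends (ONE
sector in some interior Sobolev–Serrin class L^r_t Ḣ^{1/2+2/r}_x, 2 < r < ∞ ⟹ the solution extends);
G = DegenerateTransferExtends (the transfer
parallelepiped (ω₋,u,ω₊) asymptotically flat at the critical scale ⟹ extends); X₃″ =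
NoGenericAmbichiralTypeIIBlowup (declared residual: N12's
ambichiral Type-II cell minus S's and G's cells); P1 = NoTypeIBlowup (1217). X ⟺ Clay (A) exactly
and X₃′ ⟺ S♭ ∧ G♭ ∧ X₃″ exactly (kernel,
seat file HOME/decomp-ns-lens-1/ChiralSerrinLadder.lean: root_iff_pieces, X₃'_iff_recut,
X₃''_of_X₃').
Lean: `theorem closes (h₁ : OneSectorDissipationExtends) (h₂ : OneSectorCriticalExtends) (hS :
OneSectorSerrinExtends) (hG : DegenerateTransferExtends) (h₃ : NoGenericAmbichiralTypeIIBlowup) (hP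
: NoTypeIBlowup) : NavierStokesRegularity` — SIX binders, all consumed
(navierStokesRegularity_of_noBlowup + excluded middle ×5).

## Assembly
Pure logic inside the landed frame: Theorems.navierStokesRegularity_of_noBlowup reduces Clay (A) to
«every classical Leray–Hopf solution from a
rapidly decaying datum extends past T»; given such a solution, excluded middle on IsTypeIBlowup (→
P1), on «some sector has finite dissipation»
(→ X₁), on «some sector is critically bounded» (→ X₂), on «some sector is in an interior Serrin
class» (→ S), on «asymptotically degenerate
transfer» (→ G), else X₃″. The deciding theorem closes in glue.lean consumes all six.

Rationale: WHY THIS LINE. The two helical (curl-eigen) sectors of a divergence-free field talk through ONE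
scalar, the transfer term τ = ∫det(ω₋,u,ω₊)
(LernerVigneron2022 Prop. 14: ½h_σ' + νd_σ = −τ for both σ), so a hypothesis on ONE sector controls
the whole critical energy h = ‖u‖²_{Ḣ^{1/2}}
through a duality bound on τ — an identity a Cartesian component does not have (the one-component
criteria of CheminZhang2016 / Chemin–Zhang–Zhang
need anisotropic Littlewood–Paley). N12 booked the endpoint rungs only; the interior Serrin rungs
close by a Kato–Ponce count (KatoPonce1988;
Sobolev BahouriCheminDanchin2011 Thm 1.38) whose last admissible exponent q₁ = 3r/2 is finite
exactly when r < ∞ — the ladder's ceiling is the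
one-sector Escauriaza–Seregin–Šverák endpoint X₂ (EscauriazaSereginSverak2003), re-enacting the
Prodi–Serrin → ESS history one sector at a time.
The second dial is the GEOMETRY of τ's integrand: if the parallelepiped (ω₋,u,ω₊) flattens relative
to the critical norm, Hölder + Ḣ^{1/2} ⊂ L³
(three times) + AM–GM turn the balance law into a barrier h' ≤ 8π(d₊d₋)^{1/2}(θC³h^{1/2} − 2πν) — a
sector-resolved, all-blow-up-types form of
the near-Beltrami depletion criteria (FarhatGrujic2018 Thm 1, Beirão da Veiga–Berselli 2009; tree
Theses/LocalLambTubeDoor, Type-I and PROVED).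
Imported area: helical-mode analysis of turbulence (Waleffe1992, BiferaleTiti2013) and fractional
Leibniz calculus pointed at blow-up
classification. Both new pieces end in the PROVED Ḣ^{1/2}-ESS endpoint of the seat file (from
FluidComputer.CriticalDivergence).

RANKED CRUXES. #2 OneSectorSerrinExtends (crux) — ONE-SECTOR SERRIN CRITERION (S; WEAKER · NOT IN
PRINT · ATTACKABLE NOW, expected theorem for every finite r) — for ν>0, T>0 and (u,p) classical NS
on ℝ³×[0,T), Leray–Hopf from the rapidly decaying slice u(0): if for some σ ∈ {1,−1} and some real r
> 2 the spin-σ sector lies in the Sobolev–Serrin class L^r_t Ḣ^{1/2+2/r}_x on (0,T) (certified by a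
measurable integrable majorant), then u extends smoothly past T. [difficulty: L] (why it might fail:
only through the bookkeeping of the sector balance law along tree classical solutions
(time-differentiability of h_σ, slice regularity at t>0 not a field of the predicates); the duality
× Kato–Ponce count h' ≤ Cν^{1−r}N^r h is closed for every finite r.) [arXiv:2203.07950,
KatoPonce1988, BahouriCheminDanchin2011, CheminZhang2016, EscauriazaSereginSverak2003]
#3 DegenerateTransferExtends (crux) — TRANSFER-GEOMETRY FLOOR (G; WEAKER · NOT IN PRINT · ATTACKABLE
NOW) — same frame: if the transfer parallelepiped is asymptotically degenerate at the critical scale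
(for every ε>0 a tail [t₁,T) and θ ≥ 0 with θ·‖u(t₁)‖_{Ḣ^{1/2}} ≤ ε on which u(t), ω₊(t), ω₋(t) are
L² and |det(ω₋,u,ω₊)| ≤ θ|ω₋||u||ω₊| a.e.), then u extends smoothly past T. [difficulty: M] (why it
might fail: only through the same balance-law bookkeeping (finiteness of d_σ and continuity of h
before T); the barrier h' ≤ 8π(d₊d₋)^{1/2}(θC³h^{1/2} − 2πν) with θC³h(t₁)^{1/2} ≤ πν is three
lines.) [arXiv:2203.07950, arXiv:1804.08238, FarhatGrujic2018, BahouriCheminDanchin2011]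
#4 NoGenericAmbichiralTypeIIBlowup (crux) — NO GENERIC AMBICHIRAL TYPE-II BLOW-UP (X₃″, DECLARED
RESIDUAL; weaker than X₃′ = 28743 by kernel) — same frame: if u is NOT Type I at T, every sector σ ∈
{1,−1} has infinite Ḣ^{3/2}-dissipation and is unbounded in Ḣ^{1/2}, NO sector lies in any interior
Serrin class (all r > 2), and the transfer geometry is NOT asymptotically degenerate, then u extends
smoothly past T. [difficulty: open-problem] (why it might fail: every mirror-symmetric blow-up
candidate (Luo–Hou 2014, Hou 2022) with general-position geometry sits here; it is X₃′ off two
further cells and no attack is proposed (instrument T-chiral-4 requested).) [arXiv:1402.0290,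
arXiv:2107.06509, arXiv:2203.07950, Fefferman2000]
#5 OneSectorDissipationExtends (crux) — N12's X₁ = stmt-NavierStokesRegularity-28741 verbatim (r = 2
rung; dedup by signature) — same frame: one sector with finite Ḣ^{3/2}-dissipation on (0,T) ⟹ u
extends smoothly past T. [difficulty: L] (why it might fail: only through the regularity bookkeeping
of the sector balance law along tree classical solutions; the Gronwall chain is checked (N12, critic
row 55).) [arXiv:2203.07950, arXiv:1505.00142, EscauriazaSereginSverak2003]
#6 OneSectorCriticalExtends (crux) — N12's X₂ = stmt-NavierStokesRegularity-28742 verbatim (r = ∞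
rung = the ladder's CEILING, one-sector ESS; dedup by signature) — same frame: one sector bounded in
Ḣ^{1/2} on [0,T) ⟹ u extends smoothly past T. [difficulty: open-problem] (why it might fail: the
Kato–Ponce count needs q₁ = 3r/2 < ∞; at r = ∞ the transfer bound wants Ḣ^{3/2} ⊂ L^∞ — a polarised
Type-II blow-up with a bounded minor sector is excluded by nothing known.) [arXiv:2203.07950,
CheminZhang2016, EscauriazaSereginSverak2003]
#7 NoTypeIBlowup (crux) — P1 = stmt-NavierStokesRegularity-1217 verbatim (dedup by signature) — same
frame: if u is Type I at T then u extends smoothly past T. [difficulty: open-problem] (why it might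
fail: a backward self-similar / DSS Type-I profile realised from a Schwartz datum refutes it; the
KNSS Liouville conjecture is open.) [arXiv:0709.3599, KochNadirashviliSereginSverak2009,
arXiv:1811.00502]
#9 SerrinSectorGronwallBound (support) — BC3 STUB of S (the PDE content) — same frame: a Serrin
sector (some σ, some r > 2) bounds the FULL solution in Ḣ^{1/2} on [0,T) (balance law + duality ×
Kato–Ponce transfer bound + Young + Gronwall); with the proved Ḣ^{1/2}-ESS endpoint it gives S.
[difficulty: L] [arXiv:2203.07950, KatoPonce1988, BahouriCheminDanchin2011]
#9 DegenerateBarrierBound (support) — BC3 STUB of G (the PDE content) — same frame: asymptotically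
degenerate transfer geometry bounds the FULL solution in Ḣ^{1/2} on [0,T) (balance law + Hölder +
Ḣ^{1/2} ⊂ L³ ×3 + AM–GM + barrier); with the proved endpoint it gives G. [difficulty: M]
[arXiv:2203.07950, arXiv:1804.08238]
#9 OneSectorSerrinExtendsFlat (support) — RESTRICTED TWIN S♭ (exactness bookkeeping; implied by S) —
S on N12's residual cell only: not Type I, every sector with infinite dissipation and unbounded in
Ḣ^{1/2}, and some sector in an interior Serrin class ⟹ extends. [difficulty: L] [arXiv:2203.07950]
#9 DegenerateTransferExtendsFlat (support) — RESTRICTED TWIN G♭ (exactness bookkeeping; implied by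
G) — G on N12's residual cell minus S's cell ⟹ extends. [difficulty: M] [arXiv:2203.07950,
arXiv:1804.08238]

TWO-LAYER PLAN. S ⇐ SerrinSectorGronwallBound → (Ḣ^{1/2}-bounded ⟹ extends, proved in the seat file
as extends_of_homSobolevHalf_bounded) → S, with the stub split
SectorBalanceLaw (shared with X₁'s ChiralGronwallBound and with G) → SerrinTransferBound (duality ×
Kato–Ponce) → Gronwall; G ⇐ DegenerateBarrierBound
→ endpoint → G, stubs SectorBalanceLaw → DegenerateBarrier.

KILL CRITERIA. A refutation of S (a classical solution with a Serrin sector that blows up) or of G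
(a blow-up along an asymptotically flat transfer geometry)
closes the corresponding rung and shrinks the node to N12 (the residual X₃″ re-absorbs the cell: X₃′
survives); a refutation of X₁ closes N12 and
this child (S contains the r ↓ 2 limit only formally, but the method is the same); a proof of 0056
elsewhere moots S♭, G♭, X₃″ (S and G stay
meaningful theorems but leave the cone).

NOT DECOMPOSED YET. The typed sector balance law (support lemma SectorBalanceLaw, to be filed with
--supports by the first prover of X₁/S/G); the fractional Leibniz
fact (KatoPonce1988 / Kenig–Ponce–Vega) as a Literature statement; X₃″ (declared residual;
instrument T-chiral-4 requested).

CHEAPEST FALSIFIER. Re-derive the S exponent count at one interior r (r = 4: a = 0, plain Leibniz,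
q₁ = 6, q₂ = 3) and at one r < 4 (r = 3: Hölder only) — done in
NODE-g6.md §S; then the in-Lean junk audit of the two new cell predicates (guards make junk slices
FAIL TransferDegenerateOn; ⊤-rpow in
SerrinSectorOn only on null time sets) — BC7 probes 3/3 CLEAN.

DEFINITION REQUESTS. Literature/Analysis/FluidPDE/HelicalSectorTransfer.lean
(HelicalSector.curlSymbol / sectorCurl / det3 / TransferDegenerateOn /
AsymptoticallyDegenerateTransfer / SerrinSectorOn + det3_*, TransferDegenerateOn.mono/of_le,
asymptoticallyDegenerateTransfer_of_zero,
serrinSectorOn_two_iff) PROPOSED as p763809 (definition, reviewed); the items above elaborate once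
it lands.

Novelty: Searches (2026-08-30): lit search --hybrid «regularity criterion Navier-Stokes helical decomposition
spin-definite components triple product vorticity geometric depletion» (textbooks only); lit vsearch
«regularity criterion … one helical (spin-definite) component … in a Serrin or critical Sobolev
class» (8 docs: Robinson–Rodrigo–Sadowska p172, Seregin 2014 p170 — full-field Serrin pages); lit
vsearch «scalar triple product of velocity and vorticity components, geometric depletion …
coplanarity prevents blow-up» (Majda–Bertozzi p227 vorticity-direction depletion; nothing
sector-resolved); lit galaxy search «helical decomposition|helical modes|Lamb vector» and «helical
mode decomposition|helical wave decomposition|positive and negative helical» --star pdf (MHD shell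
models, swirling jets: 0 relevant); rg over Summits/NavierStokesRegularity/*/Theses for
Serrin.*sector|spinSymbol|det(ω — only N12.
Nearest prior art found: arXiv:2203.07950 Thm 9 / Thm 11 / Thm 13 / Prop. 14 (sizes of N_σ,
spin-definite, log-imbalance); CheminZhang2016 and Chemin–Zhang–Zhang 2017 (one Cartesian COMPONENT
in L^rḢ^{1/2+2/r}); arXiv:1804.08238 Thm 1 and Beirão da Veiga–Berselli 2009 (two-vector
near-Beltrami depletion, local / Type I); tree Theses/LocalLambTubeDoor (PROVED Type-I Lamb door),
Theses/OneComponentPincer (Cartesian, Type I); arXiv:1303.1215 (helically decimated NS).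
Delta: the curl-eigen-sector carries an exact one-scalar transfer identity, so the one-sector Serrin
ladder closes by a Kato  [refs: 2203.07950, 1804.08238, 1303.1215, CheminZhang2016]

Barriers (technique_class: chirality-sector Leibniz rungs; triple-product flatness): - technique_class: chirality-sector Leibniz rungs; triple-product flatness (helical /
curl-eigen-sector decomposition; one-sector Sobolev–Serrin ladder closed by a Kato–Ponce–Leibniz
count and Grönwall; transfer-parallelepiped flatness = sector-resolved depletion)
- Literature.Barriers.NavierStokesRegularity.AveragedTypeIBlowup: S and G use the exact trilinear
transfer identity of NS (one τ shared by both sector balances), which an averaged bilinear operator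
keeping energy and helicity need not keep (Tao Rem. 4.3 keeps the helicity INTEGRAL only) — outside
for S, G; X₃″ does not evade it (declared residual).
- Literature.Barriers.NavierStokesRegularity.EnergySupercriticality: outside — every one-sector
class L^rḢ^{1/2+2/r} is scale-invariant and the grade θ‖u‖_{Ḣ^{1/2}}/ν is dimensionless; conclusions
go through the ESS endpoint; X₃″ sits inside (declared).
- Barriers/NavierStokesRegularity/EnstrophyODENoGlobalClosure.lean (file path): outside — S's
differential inequality is LINEAR in h with an L¹(0,T) coefficient (h' ≤ Cν^{1−r}N^r h, global
Gronwall), G's is a sign barrier (h' ≤ 0 while θC³h^{1/2} < 2πν); neither is the cubic self-closing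
law the barrier kills.
- Barriers/NavierStokesRegularity/VortexStretchingAprioriBounds.lean (file path): outside — no
pointwise quantity is bounded by a conserved one; the control is a critical HYPOTHESIS (cell
predicate), the conclusion a continuation criterion.
- Barriers/NavierStokesRegularity/BeltramiNonlinearity.lean (file path) / Bel

sub-problem: NavierStokesRegularity · status: open · opened planner-decomp-ns-writer-1-g3-0 2026-08-30T07:21:00Z · rev 0 · ledger route-NavierStokesRegularity-RootDecompChiralSerrin
GENERATED by the gate from the ledger (D-0016/17). Provers cite these decls: `theorem foo : Summit.NavierStokesRegularity.NavierStokesRegularity.Theses.RootDecompChiralSerrin.<Decl> := …` in Summits/NavierStokesRegularity/NavierStokesRegularity/Theorems/<Name>.lean.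
-/

namespace Summit.NavierStokesRegularity.NavierStokesRegularity.Theses.RootDecompChiralSerrin

open scoped BigOperators Topology Manifold Classical MeasureTheory ProbabilityTheory Matrix InnerProductSpace ComplexConjugate ContinuousMap
open Filter Set Function TopologicalSpace MeasureTheory

attribute [summit_statement] _root_.NavierStokesRegularity

open Literature.NS

/-- item stmt-NavierStokesRegularity-30121 · crux · rank 2 · open · by planner
why it might fail: only through the bookkeeping of the sector balance law along tree classical solutions (time-differentiability of h_σ, slice regularity at t>0 not a field of the predicates); the duality × Kato–Ponce count h' ≤ Cν^{1−r}N^r h is closed for every finite r.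
sources: arXiv:2203.07950, KatoPonce1988, BahouriCheminDanchin2011, CheminZhang2016, EscauriazaSereginSverak2003
[crux] ONE-SECTOR SERRIN CRITERION (S; WEAKER · NOT IN PRINT · ATTACKABLE NOW, expected theorem for
every finite r) — for ν>0, T>0 and (u,p) classical NS on ℝ³×[0,T), Leray–Hopf from the rapidly
decaying slice u(0): if for some σ ∈ {1,−1} and some real r > 2 the spin-σ sector lies in the
Sobolev–Serrin class L^r_t Ḣ^{1/2+2/r}_x on (0,T) (certified by a measurable integrable majorant),
then u extends smoothly past T. [difficulty: L] -/
@[route_item "route-NavierStokesRegularity-RootDecompChiralSerrin", crux]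
def OneSectorSerrinExtends : Prop :=
  ∀ (ν T : ℝ), 0 < ν → 0 < T → ∀ (u : ℝ → EuclideanSpace ℝ (Fin 3) → EuclideanSpace ℝ (Fin 3)) (p : ℝ → EuclideanSpace ℝ (Fin 3) → ℝ), Literature.Analysis.FluidPDE.IsClassicalNSSolutionOn (Set.Ico 0 T) ν 0 u p → Literature.Analysis.FluidPDE.IsLerayHopfOn T ν 0 (u 0) u → Literature.Analysis.FluidPDE.HasRapidSpatialDecay (u 0) → (∃ σ : ℝ, (σ = 1 ∨ σ = -1) ∧ ∃ r : ℝ, 2 < r ∧ Literature.Analysis.FluidPDE.HelicalSector.SerrinSectorOn σ r u T) → Literature.Analysis.FluidPDE.HasSmoothExtensionPast ν 0 u T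

/-- item stmt-NavierStokesRegularity-30122 · crux · rank 3 · open · by planner
why it might fail: only through the same balance-law bookkeeping (finiteness of d_σ and continuity of h before T); the barrier h' ≤ 8π(d₊d₋)^{1/2}(θC³h^{1/2} − 2πν) with θC³h(t₁)^{1/2} ≤ πν is three lines.
sources: arXiv:2203.07950, arXiv:1804.08238, FarhatGrujic2018, BahouriCheminDanchin2011
[crux] TRANSFER-GEOMETRY FLOOR (G; WEAKER · NOT IN PRINT · ATTACKABLE NOW) — same frame: if the
transfer parallelepiped is asymptotically degenerate at the critical scale (for every ε>0 a tail
[t₁,T) and θ ≥ 0 with θ·‖u(t₁)‖_{Ḣ^{1/2}} ≤ ε on which u(t), ω₊(t), ω₋(t) are L² and |det(ω₋,u,ω₊)|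
≤ θ|ω₋||u||ω₊| a.e.), then u extends smoothly past T. [difficulty: M] -/
@[route_item "route-NavierStokesRegularity-RootDecompChiralSerrin", crux]
def DegenerateTransferExtends : Prop :=
  ∀ (ν T : ℝ), 0 < ν → 0 < T → ∀ (u : ℝ → EuclideanSpace ℝ (Fin 3) → EuclideanSpace ℝ (Fin 3)) (p : ℝ → EuclideanSpace ℝ (Fin 3) → ℝ), Literature.Analysis.FluidPDE.IsClassicalNSSolutionOn (Set.Ico 0 T) ν 0 u p → Literature.Analysis.FluidPDE.IsLerayHopfOn T ν 0 (u 0) u → Literature.Analysis.FluidPDE.HasRapidSpatialDecay (u 0) → Literature.Analysis.FluidPDE.HelicalSector.AsymptoticallyDegenerateTransfer u T → Literature.Analysis.FluidPDE.HasSmoothExtensionPast ν 0 u T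

/-- item stmt-NavierStokesRegularity-30123 · crux · rank 4 · open · by planner
why it might fail: every mirror-symmetric blow-up candidate (Luo–Hou 2014, Hou 2022) with general-position geometry sits here; it is X₃′ off two further cells and no attack is proposed (instrument T-chiral-4 requested).
sources: arXiv:1402.0290, arXiv:2107.06509, arXiv:2203.07950, Fefferman2000
[crux] NO GENERIC AMBICHIRAL TYPE-II BLOW-UP (X₃″, DECLARED RESIDUAL; weaker than X₃′ = 28743 by
kernel) — same frame: if u is NOT Type I at T, every sector σ ∈ {1,−1} has infinite
Ḣ^{3/2}-dissipation and is unbounded in Ḣ^{1/2}, NO sector lies in any interior Serrin class (all r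
> 2), and the transfer geometry is NOT asymptotically degenerate, then u extends smoothly past T.
[difficulty: open-problem] -/
@[route_item "route-NavierStokesRegularity-RootDecompChiralSerrin", crux]
def NoGenericAmbichiralTypeIIBlowup : Prop :=
  ∀ (ν T : ℝ), 0 < ν → 0 < T → ∀ (u : ℝ → EuclideanSpace ℝ (Fin 3) → EuclideanSpace ℝ (Fin 3)) (p : ℝ → EuclideanSpace ℝ (Fin 3) → ℝ), Literature.Analysis.FluidPDE.IsClassicalNSSolutionOn (Set.Ico 0 T) ν 0 u p → Literature.Analysis.FluidPDE.IsLerayHopfOn T ν 0 (u 0) u → Literature.Analysis.FluidPDE.HasRapidSpatialDecay (u 0) → ¬ Literature.Analysis.FluidPDE.IsTypeIBlowup u T → (∀ σ : ℝ, (σ = 1 ∨ σ = -1) → ¬ Literature.Analysis.FluidPDE.HelicalSector.DissipationFiniteOn σ u T) → (∀ σ : ℝ, (σ = 1 ∨ σ = -1) → ¬ Literature.Analysis.FluidPDE.HelicalSector.CriticallyBoundedOn σ u T) → (∀ σ : ℝ, (σ = 1 ∨ σ = -1) → ∀ r : ℝ, 2 < r → ¬ Literature.Analysis.FluidPDE.HelicalSector.SerrinSectorOn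 σ r u T) → ¬ Literature.Analysis.FluidPDE.HelicalSector.AsymptoticallyDegenerateTransfer u T → Literature.Analysis.FluidPDE.HasSmoothExtensionPast ν 0 u T

/-- item stmt-NavierStokesRegularity-28741 · crux · rank 5 · open · by planner
why it might fail: only through the regularity bookkeeping of the sector balance law along tree classical solutions; the Gronwall chain is checked (N12, critic row 55).
sources: arXiv:2203.07950, arXiv:1505.00142, EscauriazaSereginSverak2003
[crux] ONE-SECTOR DISSIPATION CRITERION (X₁, r = 2 rung; WEAKER · ATTACKABLE NOW) — for ν>0, T>0 and
(u,p) classical NS on ℝ³×[0,T), Leray–Hopf from the rapidly decaying slice u(0): if for some σ ∈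
{1,−1} the spin-σ sector has finite Ḣ^{3/2}-dissipation on (0,T) (certified by a measurable
integrable majorant), then u extends smoothly past T. [difficulty: L] -/
@[route_item "route-NavierStokesRegularity-RootDecompChiralSerrin", crux]
def OneSectorDissipationExtends : Prop :=
  ∀ (ν T : ℝ), 0 < ν → 0 < T → ∀ (u : ℝ → EuclideanSpace ℝ (Fin 3) → EuclideanSpace ℝ (Fin 3)) (p : ℝ → EuclideanSpace ℝ (Fin 3) → ℝ), Literature.Analysis.FluidPDE.IsClassicalNSSolutionOn (Set.Ico 0 T) ν 0 u p → Literature.Analysis.FluidPDE.IsLerayHopfOn T ν 0 (u 0) u → Literature.Analysis.FluidPDE.HasRapidSpatialDecay (u 0) → (∃ σ : ℝ, (σ = 1 ∨ σ = -1) ∧ Literature.Analysis.FluidPDE.HelicalSector.DissipationFiniteOn σ u T) → Literature.Analysis.FluidPDE.HasSmoothExtensionPast ν 0 u T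

/-- item stmt-NavierStokesRegularity-28742 · crux · rank 6 · open · by planner
why it might fail: the Kato–Ponce count needs q₁ = 3r/2 < ∞; at r = ∞ the transfer bound wants Ḣ^{3/2} ⊂ L^∞ — a polarised Type-II blow-up with a bounded minor sector is excluded by nothing known.
sources: arXiv:2203.07950, CheminZhang2016, EscauriazaSereginSverak2003
[crux] ONE-SECTOR ESS (X₂, r = ∞ rung; WEAKER · IDEA-NEEDED) — same frame: if for some σ ∈ {1,−1}
the spin-σ sector is bounded in Ḣ^{1/2} on [0,T) by a finite M, then u extends smoothly past T.
[difficulty: open-problem] -/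
@[route_item "route-NavierStokesRegularity-RootDecompChiralSerrin", crux]
def OneSectorCriticalExtends : Prop :=
  ∀ (ν T : ℝ), 0 < ν → 0 < T → ∀ (u : ℝ → EuclideanSpace ℝ (Fin 3) → EuclideanSpace ℝ (Fin 3)) (p : ℝ → EuclideanSpace ℝ (Fin 3) → ℝ), Literature.Analysis.FluidPDE.IsClassicalNSSolutionOn (Set.Ico 0 T) ν 0 u p → Literature.Analysis.FluidPDE.IsLerayHopfOn T ν 0 (u 0) u → Literature.Analysis.FluidPDE.HasRapidSpatialDecay (u 0) → (∃ σ : ℝ, (σ = 1 ∨ σ = -1) ∧ Literature.Analysis.FluidPDE.HelicalSector.CriticallyBoundedOn σ u T) → Literature.Analysis.FluidPDE.HasSmoothExtensionPast ν 0 u T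

/-- item stmt-NavierStokesRegularity-1217 · crux · rank 7 · open · by planner
why it might fail: a backward self-similar / DSS Type-I profile realised from a Schwartz datum refutes it; the KNSS Liouville conjecture is open.
sources: arXiv:0709.3599, KochNadirashviliSereginSverak2009, arXiv:1811.00502
[target] X = NO TYPE-I BLOW-UP FOR CLAY DATA: a classical solution of unforced NS on ℝ³×[0,T) which
is Leray–Hopf from a rapidly decaying datum and blows up at most at the Type-I rate ‖u(t)‖∞ ≤
C(T−t)^{-1/2} extends smoothly past T. Equals UnthreadedNoBlowup ∧ ThreadedNoBlowup by excluded
middle on 'every point is unthreaded' (proved in the planner's Sketch.lean: target_of_cruxes); it is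
the unconditional conclusion of stmt-NavierStokesRegularity-0058 (route TypeILiouville, which
assumes (L)). With NoTypeII (stmt-0056) it gives NoBlowup (stmt-0054). Card:
threading-flux-trace-topology. -/
@[route_item "route-NavierStokesRegularity-RootDecompChiralSerrin", crux]
def NoTypeIBlowup : Prop :=
  ∀ (ν T : ℝ), 0 < ν → 0 < T → ∀ (u : ℝ → EuclideanSpace ℝ (Fin 3) → EuclideanSpace ℝ (Fin 3)) (p : ℝ → EuclideanSpace ℝ (Fin 3) → ℝ), Literature.Analysis.FluidPDE.IsClassicalNSSolutionOn (Set.Ico 0 T) ν 0 u p → Literature.Analysis.FluidPDE.IsLerayHopfOn T ν 0 (u 0) u → Literature.Analysis.FluidPDE.HasRapidSpatialDecay (u 0) → Literature.Analysis.FluidPDE.IsTypeIBlowup u T → Literature.Analysis.FluidPDE.HasSmoothExtensionPast ν 0 u T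

/-- item stmt-NavierStokesRegularity-30124 · aside · rank 9 · open · by planner
sources: arXiv:2203.07950, KatoPonce1988, BahouriCheminDanchin2011
[support] BC3 STUB of S (the PDE content) — same frame: a Serrin sector (some σ, some r > 2) bounds
the FULL solution in Ḣ^{1/2} on [0,T) (balance law + duality × Kato–Ponce transfer bound + Young +
Gronwall); with the proved Ḣ^{1/2}-ESS endpoint it gives S. [difficulty: L] -/
@[route_item "route-NavierStokesRegularity-RootDecompChiralSerrin"]
def SerrinSectorGronwallBound : Prop :=
  ∀ (ν T : ℝ), 0 < ν → 0 < T → ∀ (u : ℝ → EuclideanSpace ℝ (Fin 3) → EuclideanSpace ℝ (Fin 3)) (p : ℝ → EuclideanSpace ℝ (Fin 3) → ℝ), Literature.Analysis.FluidPDE.IsClassicalNSSolutionOn (Set.Ico 0 T) ν 0 u p → Literature.Analysis.FluidPDE.IsLerayHopfOn T ν 0 (u 0) u → Literature.Analysis.FluidPDE.HasRapidSpatialDecay (u 0) → (∃ σ : ℝ, (σ = 1 ∨ σ = -1) ∧ ∃ r : ℝ, 2 < r ∧ Literature.Analysis.FluidPDE.HelicalSector.SerrinSectorOn σ r u T) →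 ∃ M : NNReal, ∀ t ∈ Set.Ico 0 T, Function.eHomSobolevSeminorm (1 / 2 : ℝ) (Literature.Analysis.FunctionSpaces.EuclideanSpace.complexify ∘ u t) ≤ (M : ENNReal)

/-- item stmt-NavierStokesRegularity-30125 · aside · rank 9 · open · by planner
sources: arXiv:2203.07950, arXiv:1804.08238
[support] BC3 STUB of G (the PDE content) — same frame: asymptotically degenerate transfer geometry
bounds the FULL solution in Ḣ^{1/2} on [0,T) (balance law + Hölder + Ḣ^{1/2} ⊂ L³ ×3 + AM–GM +
barrier); with the proved endpoint it gives G. [difficulty: M] -/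
@[route_item "route-NavierStokesRegularity-RootDecompChiralSerrin"]
def DegenerateBarrierBound : Prop :=
  ∀ (ν T : ℝ), 0 < ν → 0 < T → ∀ (u : ℝ → EuclideanSpace ℝ (Fin 3) → EuclideanSpace ℝ (Fin 3)) (p : ℝ → EuclideanSpace ℝ (Fin 3) → ℝ), Literature.Analysis.FluidPDE.IsClassicalNSSolutionOn (Set.Ico 0 T) ν 0 u p → Literature.Analysis.FluidPDE.IsLerayHopfOn T ν 0 (u 0) u → Literature.Analysis.FluidPDE.HasRapidSpatialDecay (u 0) → Literature.Analysis.FluidPDE.HelicalSector.AsymptoticallyDegenerateTransfer u T → ∃ M : NNReal, ∀ t ∈ Set.Ico 0 T, Function.eHomSobolevSeminorm (1 / 2 : ℝ) (Literature.Analysis.FunctionSpaces.EuclideanSpace.complexify ∘ u t) ≤ (M : ENNReal)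

/-- item stmt-NavierStokesRegularity-30126 · aside · rank 9 · open · by planner
sources: arXiv:2203.07950
[support] RESTRICTED TWIN S♭ (exactness bookkeeping; implied by S) — S on N12's residual cell only:
not Type I, every sector with infinite dissipation and unbounded in Ḣ^{1/2}, and some sector in an
interior Serrin class ⟹ extends. [difficulty: L] -/
@[route_item "route-NavierStokesRegularity-RootDecompChiralSerrin"]
def OneSectorSerrinExtendsFlat : Prop :=
  ∀ (ν T : ℝ), 0 < ν → 0 < T → ∀ (u : ℝ → EuclideanSpace ℝ (Fin 3) → EuclideanSpace ℝ (Fin 3)) (p : ℝ → EuclideanSpace ℝ (Fin 3) → ℝ), Literature.Analysis.FluidPDE.IsClassicalNSSolutionOn (Set.Ico 0 T) ν 0 u p → Literature.Analysis.FluidPDE.IsLerayHopfOn T ν 0 (u 0) u → Literature.Analysis.FluidPDE.HasRapidSpatialDecay (u 0) → ¬ Literature.Analysis.FluidPDE.IsTypeIBlowup u T → (∀ σ : ℝ, (σ = 1 ∨ σ = -1) → ¬ Literature.Analysis.FluidPDE.HelicalSector.DissipationFiniteOn σ u T) → (∀ σ : ℝ, (σ = 1 ∨ σ = -1) → ¬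 Literature.Analysis.FluidPDE.HelicalSector.CriticallyBoundedOn σ u T) → (∃ σ : ℝ, (σ = 1 ∨ σ = -1) ∧ ∃ r : ℝ, 2 < r ∧ Literature.Analysis.FluidPDE.HelicalSector.SerrinSectorOn σ r u T) → Literature.Analysis.FluidPDE.HasSmoothExtensionPast ν 0 u T

/-- item stmt-NavierStokesRegularity-30127 · aside · rank 9 · open · by planner
sources: arXiv:2203.07950, arXiv:1804.08238
[support] RESTRICTED TWIN G♭ (exactness bookkeeping; implied by G) — G on N12's residual cell minus
S's cell ⟹ extends. [difficulty: M] -/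
@[route_item "route-NavierStokesRegularity-RootDecompChiralSerrin"]
def DegenerateTransferExtendsFlat : Prop :=
  ∀ (ν T : ℝ), 0 < ν → 0 < T → ∀ (u : ℝ → EuclideanSpace ℝ (Fin 3) → EuclideanSpace ℝ (Fin 3)) (p : ℝ → EuclideanSpace ℝ (Fin 3) → ℝ), Literature.Analysis.FluidPDE.IsClassicalNSSolutionOn (Set.Ico 0 T) ν 0 u p → Literature.Analysis.FluidPDE.IsLerayHopfOn T ν 0 (u 0) u → Literature.Analysis.FluidPDE.HasRapidSpatialDecay (u 0) → ¬ Literature.Analysis.FluidPDE.IsTypeIBlowup u T → (∀ σ : ℝ, (σ = 1 ∨ σ = -1) → ¬ Literature.Analysis.FluidPDE.HelicalSector.DissipationFiniteOn σ u T) → (∀ σ : ℝ, (σ = 1 ∨ σ = -1) → ¬ Literature.Analysis.FluidPDE.HelicalSector.CriticallyBoundedOn σ u T) → (∀ σ : ℝ, (σ = 1 ∨ σ = -1) → ∀ r : ℝ, 2 < r → ¬ Literature.Analysis.FluidPDE.HelicalSector.SerrinSectorOn σ r u T) → Literature.Analysis.FluidPDE.HelicalSector.AsymptoticallyDegenerateTransfer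 u T → Literature.Analysis.FluidPDE.HasSmoothExtensionPast ν 0 u T

/-- item stmt-NavierStokesRegularity-30128 · assembly · rank 1 · open · by planner
sources: Fefferman2000, arXiv:2203.07950
[assembly] the implication the glue proves: X₁ → X₂ → S → G → X₃″ → P1 → Clay (A) (all six consumed;
= seat kernel `closes` via Theorems.navierStokesRegularity_of_noBlowup and excluded middle on the
five cells). -/
@[route_item "route-NavierStokesRegularity-RootDecompChiralSerrin"]
def Assembly : Prop :=
  OneSectorDissipationExtends → OneSectorCriticalExtends → OneSectorSerrinExtends → DegenerateTransferExtends → NoGenericAmbichiralTypeIIBlowup → NoTypeIBlowup → NavierStokesRegularity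

/-! D-0027 §2.1 — DECIDING THEOREM (planner-authored via `route open/edit --closes-file`; by planner-decomp-ns-writer-1-g3-0 2026-08-30T07:21:00Z):
its hypotheses are this route's items and its conclusion the sub-problem Statement (glue_lint), and it elaborates with this file. -/

@[closes "route-NavierStokesRegularity-RootDecompChiralSerrin"] theorem closes (h₁ : OneSectorDissipationExtends) (h₂ : OneSectorCriticalExtends)
    (hS : OneSectorSerrinExtends) (hG : DegenerateTransferExtends)
    (h₃ : NoGenericAmbichiralTypeIIBlowup) (hP : NoTypeIBlowup) : NavierStokesRegularity := by
  refine Summit.NavierStokesRegularity.NavierStokesRegularity.Theorems.navierStokesRegularity_of_noBlowup ?_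
  intro ν T hν hT u p hcl hLH hdec
  by_cases hI : Literature.Analysis.FluidPDE.IsTypeIBlowup u T
  · exact hP ν T hν hT u p hcl hLH hdec hI
  by_cases hd : ∃ σ : ℝ, (σ = 1 ∨ σ = -1) ∧ Literature.Analysis.FluidPDE.HelicalSector.DissipationFiniteOn σ u T
  · exact h₁ ν T hν hT u p hcl hLH hdec hd
  by_cases hc : ∃ σ : ℝ, (σ = 1 ∨ σ = -1) ∧ Literature.Analysis.FluidPDE.HelicalSector.CriticallyBoundedOn σ u T
  · exact h₂ ν T hν hT u p hcl hLH hdec hc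
  by_cases hs : ∃ σ : ℝ, (σ = 1 ∨ σ = -1) ∧ ∃ r : ℝ, 2 < r ∧
      Literature.Analysis.FluidPDE.HelicalSector.SerrinSectorOn σ r u T
  · exact hS ν T hν hT u p hcl hLH hdec hs
  by_cases hg : Literature.Analysis.FluidPDE.HelicalSector.AsymptoticallyDegenerateTransfer u T
  · exact hG ν T hν hT u p hcl hLH hdec hg
  push Not at hd hc hs
  exact h₃ ν T hν hT u p hcl hLH hdec hI hd hc (fun σ hσ r hr => hs σ hσ r hr) hg

end Summit.NavierStokesRegularity.NavierStokesRegularity.Theses.RootDecompChiralSerrin
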